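import Mathlib
import Literature.Barriers.ValiantsHypothesis.AlgebraicNaturalProofsGenerators
import Summits.ValiantsHypothesis.ValiantsHypothesis.Theorems.BarrierLeverSuccinctHittingSetsForVPGeneratorEquivalence
import HarnessLib

/-!
# Crux `BarrierLever.SuccinctHittingSetsForVP` (stmt-ValiantsHypothesis-14610) — FSV LEMMA 13 AT
EVERY LEVEL: succinct hitting sets give succinct GENERATORS (the converse of the landed door
`succinctHittingSetsForVP_of_generators`), so over `ℂ` the crux is EQUIVALENT to the
generator hypothesis `SuccinctGeneratorsForVP ℂ` of
`Literature/Barriers/ValiantsHypothesis/AlgebraicNaturalProofsGenerators.lean`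

**What is proved (unconditional; an EQUIVALENT form of the crux, it does NOT close the item).**

* `succinctGeneratorsForVP_of_succinctHittingSets` — if `SuccinctHittingSetsForVP ℂ` (FSV Question 6)
  then for every distinguisher level `a` there are `b', n₀` and, for each `n ≥ n₀`, ONE polynomial
  map `G` (Raz's universal circuit map of `exists_generator`, onto the hitting class
  `SmallCircuits ℂ n b` and into `SmallCircuits ℂ n (5b+22)`) which is a hitting set GENERATOR for
  `Distinguishers ℂ n a` (`IsHittingSetGenerator`: `D ≠ 0 ⇒ D ∘ G ≠ 0`) and is
  `SmallCircuits ℂ n (5b+22)`-succinct (`IsSuccinctGenerator`). This is Forbes–Shpilka–Volk 2018,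
  Lemma 13 ("succinct hitting set ⇒ succinct generator, via a universal circuit") at the
  parameters of Cor. 15, level by level — the argument of the landed `levelOne_iff_generator`
  (forward direction) run at an arbitrary level `a` instead of `1`.
* `succinctHittingSetsForVP_iff_succinctGenerators` — hence
  `SuccinctHittingSetsForVP ℂ ↔ SuccinctGeneratorsForVP ℂ` (with the landed door direction
  `succinctHittingSetsForVP_of_generators`, FSV Lemma 14), making the door file's "equivalent over
  large fields" literal in the tree (referee REF-GENERATORS B12/D2 of the cell `valiant-natproofs`),
  and `crux_iff_succinctGenerators` for the route decl.

Axioms: `propext`, `Classical.choice`, `Quot.sound`. References: [ForbesShpilkaVolk2018] §3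
Lemma 13, Lemma 14, Cor. 15; [Raz2010] Prop. 3.3 (the universal circuit behind `exists_generator`).
-/

-- layout Summits/ValiantsHypothesis/ValiantsHypothesis forces the duplicated namespace component
set_option linter.dupNamespace false

namespace Summit.ValiantsHypothesis.ValiantsHypothesis.Theorems.BarrierLever.SuccinctHittingSetsForVP

open Literature.Barriers.ValiantsHypothesis Literature.Computability.AlgebraicComplexity MvPolynomial

/-- **FSV Lemma 13 at every level (universal circuits turn succinct hitting sets into succinct
generators).** `SuccinctHittingSetsForVP ℂ → SuccinctGeneratorsForVP ℂ`: at level `a`, take the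
hitting exponent `b` from Question 6 and the universal map `G` of `exists_generator b n`; a
nonzero level-`a` distinguisher is hit by some `f ∈ SmallCircuits ℂ n b`, which is a value
`G(y)`, so `(D ∘ G)(y) = D(coeff f) ≠ 0`; every value of `G` is the coefficient vector of a
polynomial of degree `≤ n` and size `≤ 21876 (n+3)^(5b+21) ≤ n^(5b+22)` for `n ≥ max(21876·2^(5b+21), 3)`.
[cite: ForbesShpilkaVolk2018, Lemma 13 and Cor. 15] -/
theorem succinctGeneratorsForVP_of_succinctHittingSets (h : SuccinctHittingSetsForVP ℂ) :
    SuccinctGeneratorsForVP ℂ := by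
  intro a
  obtain ⟨b, n₀, hhit⟩ := h a
  set A := 21876 * 2 ^ (5 * b + 21) with hA
  refine ⟨5 * b + 22, max (max n₀ A) 3, fun n hn => ?_⟩
  have hn₀ : n₀ ≤ n := le_trans (le_max_left _ _) ((le_max_left _ _).trans hn)
  have hnA : A ≤ n := le_trans (le_max_right _ _) ((le_max_left _ _).trans hn)
  have hn3 : 3 ≤ n := (le_max_right _ _).trans hn
  obtain ⟨p, G, -, -, honto, hinto⟩ := exists_generator b n (by omega)
  refine ⟨p, G, IsHittingSetGenerator.of_hits fun D hD hD0 => ?_, fun y => ?_⟩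
  · -- the hitting polynomial is a value of `G`
    obtain ⟨f, hf, hne⟩ := hhit n hn₀ D hD hD0
    obtain ⟨y, hy⟩ := honto f hf
    refine ⟨y, ?_⟩
    have hpt : coeffVector (degLEMonomials n) f = genOutput G y := by
      funext m; rw [coeffVector_apply, genOutput_apply, hy]
    rwa [← hpt]
  · -- every value of `G` is realised in `SmallCircuits ℂ n (5b+22)`
    obtain ⟨f, hfd, hfc, hcoeff⟩ := hinto y
    refine ⟨f, ⟨hfd, hfc.trans ?_⟩, funext fun m => by rw [coeffVector_apply, genOutput_apply, hcoeff]⟩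
    have h2 : (n + 3) ^ (5 * b + 21) ≤ (2 * n) ^ (5 * b + 21) := Nat.pow_le_pow_left (by omega) _
    calc 21876 * (n + 3) ^ (5 * b + 21) ≤ 21876 * (2 * n) ^ (5 * b + 21) :=
          Nat.mul_le_mul_left _ h2
      _ = A * n ^ (5 * b + 21) := by rw [hA, mul_pow]; ring
      _ ≤ n * n ^ (5 * b + 21) := Nat.mul_le_mul_right _ hnA
      _ = n ^ (5 * b + 22) := by ring

/-- **FSV Lemmas 13–14 over `ℂ`: succinct hitting sets for `VP` exist iff succinct generators for
`VP` exist** (every level). [cite: ForbesShpilkaVolk2018, Lemma 13 and Lemma 14] -/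
theorem succinctHittingSetsForVP_iff_succinctGenerators :
    SuccinctHittingSetsForVP ℂ ↔ SuccinctGeneratorsForVP ℂ :=
  ⟨succinctGeneratorsForVP_of_succinctHittingSets, succinctHittingSetsForVP_of_generators⟩

/-- The route's crux in the door vocabulary: `BarrierLever.SuccinctHittingSetsForVP` holds iff
succinct generators for `VP` over `ℂ` exist. [cite: ForbesShpilkaVolk2018, Lemma 13 and Lemma 14] -/
theorem crux_iff_succinctGenerators :
    Summit.ValiantsHypothesis.ValiantsHypothesis.Theses.BarrierLever.SuccinctHittingSetsForVP ↔
      SuccinctGeneratorsForVP ℂ :=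
  succinctHittingSetsForVP_iff_succinctGenerators

end Summit.ValiantsHypothesis.ValiantsHypothesis.Theorems.BarrierLever.SuccinctHittingSetsForVP
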